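import Summits.Ventures.CertifiedArithmetic.LowPrec.RoundTripDecision
import Summits.Ventures.CertifiedArithmetic.LowPrec.DoubleRounding

/-!
# Theorem D for double rounding of sums: when is "add in `Y`, then convert to `X`" exact-as-`X`?

HONEST FRAMING (venture CertifiedArithmetic / cell `pub-lowprec`): certified error envelopes and
provably optimal rounding/accumulation schemes for low-precision formats under stated cost models;
every table by two implementations; no hardware or vendor claims.

`DRAdd X Y`: for ALL finite data `a, b` of `X`, `fl_X (fl_Y (a + b)) = fl_X (a + b)` as values,
every rounding the cell's SATURATING round-to-nearest-even (`roundNE`; subnormals included, no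
infinities): computing the sum in an intermediate format `Y` and converting gives the correctly
rounded `X`-sum. The lean seat's `toRat_roundNE_roundNE_add` (`DoubleRounding.lean`) is the
classical sufficient condition `P_Y ≥ 2 P_X + 1` [Figueroa1995, §2]; [Rump2016, Lemma 4.4]
shows it cannot be improved for UNBOUNDED exponent range. This file supplies the other engines of
the complete decision over the named formats (`DoubleRoundingMatrix.lean`, THEOREM D-dr):

* §1 NECESSITY OF THE ROUND TRIP: `DRAdd X Y → RoundTrips X Y` (`b = 0`); with
  `RoundTripDecision.lean` every non-embedded named pair fails.
* §2 SAME PRECISION, WIDER RANGE (`drAdd_of_manBits_eq`, new): if `m_X = m_Y ≥ 1`, `L_Y ≤ L_X`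
  and `M_X ≤ M_Y` then `DRAdd X Y` — although `P_Y = P_X < 2 P_X + 1`. Core
  (`toRat_roundNE_eq_of_manBits_eq`): both formats round every multiple `t` of the `X`-quantum
  with `|t| < maxRat X` to the SAME value. Proof: if `t ∉ F_X`, its `X`-neighbours `v < t < u`
  are consecutive values of a NORMAL binade of `X` (in the unit-spacing binades every multiple of
  the quantum is a value), and there the two grids coincide — GAP TRANSPORT `gap_of_manBits_eq`:
  no value of `Y` lies strictly between `v` and `u = v + ulp_X(v)` (integer argument on scaled
  magnitudes: a `Y`-datum above a normal `X`-datum of the same significand width has at least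
  its ulp) — so off the midpoint both roundings pick the nearer of `v`, `u`; AT the midpoint both
  pick the one with even trailing significand (`roundNE_man_even_of_tie`), and PARITY TRANSPORT
  `two_dvd_man_iff_of_scaledMag_eq` (equal widths: the datum of `Y` with the value of a normal
  `X`-datum has a significand of the same parity) with the alternation `not_two_dvd_man_and_succ`
  (`RoundToOdd.lean`) forbids a disagreement. Saturation: sums beyond `±maxRat X` give `±maxRat X`
  both ways (`M_X ∈ F_Y`, monotonicity).
* §3 THE BIAS EXCEPTION. `toRat_roundNE_roundNE_add` asks `bias_X ≤ bias_Y`, which fails for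
  exactly two wide named pairs, binary8p3 / binary8p3f (bias 16) into binary16 (bias 15). PHANTOM
  WIDE FORMAT `Binary16W = ⟨10, 16, 31, 1023⟩` (binary16 with one more binade below and the same
  top): by §2 it rounds every multiple of the binary16 quantum exactly as binary16 does
  (`toRat_roundNE_Binary16W`), and the lean seat's theorem applies to `(binary8p3, Binary16W)`;
  hence `Binary8p3_add_via_Binary16`, `Binary8p3F_add_via_Binary16`.
(The witness replay for the failing cells and the kernel exhaustions live in
`DoubleRoundingMatrix.lean`.)

TWO IMPLEMENTATIONS: A = `code/enum/doubleround_decision.py` (the test on all pairs, brute force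
over every operand pair of the FP6/FP4 sources, witness replay, and the integer-model threshold
law of clause (T) verified exhaustively for `P ≤ 7`; `DOUBLE-ROUNDING.md`); B = the kernel
(this file and `DoubleRoundingMatrix.lean`). KNOWN: §3's engine and the classical bound
[Figueroa1995; Rump2016, Lemma 4.4; Roux2014; BoldoMelquiond2017, §3.2.2.3]. NEW (no statement
found in the held corpus or the galaxy corpora, queries in `DOUBLE-ROUNDING.md` §5): §2 for
embedded finite saturating formats with ties-to-even, the phantom-wide device of §3, and the
complete named matrix with its finite-range exceptions.
-/

namespace Summit.Ventures.CertifiedArithmetic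

open Literature.ComputerArithmetic.FloatingPoint
open Literature.ComputerArithmetic.FloatingPoint.Format
open Literature.ComputerArithmetic.FloatingPoint.MiniFloat

/-- DOUBLE ROUNDING OF SUMS IS INNOCUOUS for data of `φ` added in `ψ`: for all finite `a, b` of
`φ`, `fl_φ (fl_ψ (a + b)) = fl_φ (a + b)` as values (saturating RNE both times). -/
def DRAdd (φ ψ : Format) : Prop :=
  ∀ a b : MiniFloat φ,
    (roundNE φ (roundNE ψ (a.toRat + b.toRat)).toRat).toRat
      = (roundNE φ (a.toRat + b.toRat)).toRat

/-! ## §1 Necessity of the round trip -/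

/-- `b = 0`: innocuous double rounding of sums makes `φ → ψ → φ` lossless. -/
theorem roundTrips_of_drAdd {φ ψ : Format} (h : DRAdd φ ψ) : RoundTrips φ ψ := fun x => by
  have := h x (MiniFloat.zero φ)
  rwa [toRat_zero, add_zero, toRat_roundNE_toRat] at this

/-- Contrapositive: no round trip, no innocuous double rounding. -/
theorem not_drAdd_of_not_roundTrips {φ ψ : Format} (h : ¬ RoundTrips φ ψ) : ¬ DRAdd φ ψ :=
  fun hd => h (roundTrips_of_drAdd hd)

/-! ## §2 Same precision, wider range -/

/-- A coarser quantum is a power-of-two multiple of a finer one. -/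
theorem quantum_eq_two_pow_mul {φ ψ : Format} (hq : ψ.qexp ≤ φ.qexp) :
    φ.quantum = 2 ^ (φ.qexp - ψ.qexp).toNat * ψ.quantum := by
  unfold Format.quantum
  rw [← zpow_natCast, ← zpow_add₀ (by norm_num : (2:ℚ) ≠ 0), Int.toNat_of_nonneg (by omega),
    sub_add_cancel]

/-- Equal magnitudes across formats: the scaled magnitudes differ by the quantum ratio. -/
theorem scaledMag_eq_mul_of_abs_toRat_eq {φ ψ : Format} {d : ℕ}
    (hd : φ.quantum = 2 ^ d * ψ.quantum) {x : MiniFloat φ} {z : MiniFloat ψ}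
    (h : |z.toRat| = |x.toRat|) : z.scaledMag = x.scaledMag * 2 ^ d := by
  rw [abs_toRat, abs_toRat, hd, ← mul_assoc] at h
  exact_mod_cast mul_right_cancel₀ (ne_of_gt ψ.quantum_pos) h

/-- PARITY TRANSPORT: for formats of the same trailing-significand width `m ≥ 1`, a datum `z` of
`ψ` whose scaled magnitude is `2^d` times that of a NORMAL datum `x` of `φ` (same value, quanta in
ratio `2^d`) is normal with the same significand, so the two significands have the same parity. -/
theorem two_dvd_man_iff_of_scaledMag_eq {φ ψ : Format} (hm : φ.manBits = ψ.manBits)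
    (h1 : 1 ≤ φ.manBits) {x : MiniFloat φ} {z : MiniFloat ψ} {d : ℕ} (hx : 1 ≤ x.expCode)
    (hS : z.scaledMag = x.scaledMag * 2 ^ d) : 2 ∣ z.man ↔ 2 ∣ x.man := by
  have hxlo := pow_le_scaledMag_of_expCode_pos x hx
  have hxhi := scaledMag_lt_pow_ulpExp x
  have hzhi := scaledMag_lt_pow_ulpExp z
  have hz : 1 ≤ z.expCode := by
    by_contra hz0
    have hz0 : z.expCode = 0 := by omega
    have hzm : z.scaledMag < 2 ^ ψ.manBits := by
      have := z.man_lt; unfold MiniFloat.scaledMag Format.scaled; rw [if_pos hz0]; exact this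
    have h2 : 2 ^ φ.manBits ≤ x.scaledMag * 2 ^ d :=
      le_trans (Nat.pow_le_pow_right (by norm_num) (by omega))
        (le_trans hxlo (Nat.le_mul_of_pos_right _ (by positivity)))
    rw [← hS, hm] at h2
    omega
  have hzlo := pow_le_scaledMag_of_expCode_pos z hz
  have he : z.expCode - 1 = x.expCode - 1 + d := by
    have A : 2 ^ (φ.manBits + (x.expCode - 1) + d) ≤ z.scaledMag := by
      rw [hS, pow_add]; exact Nat.mul_le_mul_right _ hxlo
    have B : z.scaledMag < 2 ^ (φ.manBits + 1 + (x.expCode - 1) + d) := by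
      rw [hS, pow_add]; exact Nat.mul_lt_mul_of_pos_right hxhi (by positivity)
    rw [hm] at A B
    have C := (Nat.pow_lt_pow_iff_right (by norm_num)).mp (lt_of_le_of_lt A hzhi)
    have D := (Nat.pow_lt_pow_iff_right (by norm_num)).mp (lt_of_le_of_lt hzlo B)
    omega
  rw [two_dvd_man_iff (hm ▸ h1) z, two_dvd_man_iff h1 x, he, hS, pow_add, ← mul_assoc]
  exact Nat.mul_dvd_mul_iff_right (by positivity)

/-- GAP TRANSPORT: for formats of the same trailing-significand width whose quanta are in ratio
`2^d` (`φ` coarser), no value of `ψ` lies strictly between a nonnegative NORMAL datum `v` of `φ`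
and `v + ulp_φ(v)`: above `v` the grid of `ψ` is the grid of `φ`. -/
theorem gap_of_manBits_eq {φ ψ : Format} (hm : φ.manBits = ψ.manBits) {d : ℕ}
    (hd : φ.quantum = 2 ^ d * ψ.quantum) {v : MiniFloat φ} (hv : 1 ≤ v.expCode)
    (hv0 : 0 ≤ v.toRat) (y : MiniFloat ψ) :
    y.toRat ≤ v.toRat ∨ v.toRat + 2 ^ (v.expCode - 1) * φ.quantum ≤ y.toRat := by
  rcases le_or_gt y.toRat v.toRat with h | h
  · exact Or.inl h
  right
  have hqψ := ψ.quantum_pos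
  have hy0 : 0 ≤ y.toRat := hv0.trans h.le
  have hvS : v.toRat = (v.scaledMag : ℚ) * 2 ^ d * ψ.quantum := by
    rw [← abs_of_nonneg hv0, abs_toRat, hd]; ring
  have hyS : y.toRat = (y.scaledMag : ℚ) * ψ.quantum := by rw [← abs_of_nonneg hy0, abs_toRat]
  have hlt : v.scaledMag * 2 ^ d < y.scaledMag := by
    have : (v.scaledMag : ℚ) * 2 ^ d * ψ.quantum < (y.scaledMag : ℚ) * ψ.quantum := by
      rw [← hvS, ← hyS]; exact h
    exact_mod_cast lt_of_mul_lt_mul_right this hqψ.le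
  have hvlo := pow_le_scaledMag_of_expCode_pos v hv
  have hdv := pow_ulpExp_dvd_scaledMag v
  have hyhi := scaledMag_lt_pow_ulpExp y
  have hdy := pow_ulpExp_dvd_scaledMag y
  have key : v.scaledMag * 2 ^ d + 2 ^ (v.expCode - 1 + d) ≤ y.scaledMag := by
    rcases le_or_gt (v.expCode - 1 + d) (y.expCode - 1) with hle | hgt
    · have hd1 : 2 ^ (v.expCode - 1 + d) ∣ v.scaledMag * 2 ^ d := by
        rw [pow_add]; exact Nat.mul_dvd_mul hdv dvd_rfl
      have hd2 : 2 ^ (v.expCode - 1 + d) ∣ y.scaledMag := dvd_trans (pow_dvd_pow 2 hle) hdy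
      obtain ⟨k1, hk1⟩ := hd1
      obtain ⟨k2, hk2⟩ := hd2
      rw [hk1, hk2] at hlt ⊢
      have hk : k1 < k2 := Nat.lt_of_mul_lt_mul_left hlt
      calc 2 ^ (v.expCode - 1 + d) * k1 + 2 ^ (v.expCode - 1 + d)
          = 2 ^ (v.expCode - 1 + d) * (k1 + 1) := by ring
        _ ≤ 2 ^ (v.expCode - 1 + d) * k2 := Nat.mul_le_mul_left _ hk
    · exfalso
      have A : 2 ^ (ψ.manBits + 1 + (y.expCode - 1)) ≤ 2 ^ (φ.manBits + (v.expCode - 1) + d) :=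
        Nat.pow_le_pow_right (by norm_num) (by omega)
      have B : 2 ^ (φ.manBits + (v.expCode - 1) + d) ≤ v.scaledMag * 2 ^ d := by
        rw [pow_add]; exact Nat.mul_le_mul_right _ hvlo
      omega
  calc v.toRat + 2 ^ (v.expCode - 1) * φ.quantum
      = ((v.scaledMag * 2 ^ d + 2 ^ (v.expCode - 1 + d) : ℕ) : ℚ) * ψ.quantum := by
        rw [hvS, hd]; push_cast; ring
    _ ≤ (y.scaledMag : ℚ) * ψ.quantum := mul_le_mul_of_nonneg_right (by exact_mod_cast key) hqψ.le
    _ = y.toRat := hyS.symm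

/-- SAME PRECISION, WIDER RANGE — the core, positive arguments: for `m_φ = m_ψ ≥ 1`, `L_ψ ≤ L_φ`,
`M_φ ≤ M_ψ`, both formats round every multiple `t` of the `φ`-quantum with `0 < t < maxRat φ` to
the same value (off `F_φ`: common neighbours by gap transport; at a midpoint: the even significand,
the same on both sides by parity transport). -/
theorem toRat_roundNE_eq_of_manBits_eq_pos {φ ψ : Format} (hm : φ.manBits = ψ.manBits)
    (h1 : 1 ≤ φ.manBits) (hq : ψ.qexp ≤ φ.qexp) (hmax : φ.maxRat ≤ ψ.maxRat) {N : ℤ}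
    (h0 : 0 < (N : ℚ) * φ.quantum) (hlt : (N : ℚ) * φ.quantum < φ.maxRat) :
    (roundNE ψ ((N : ℚ) * φ.quantum)).toRat = (roundNE φ ((N : ℚ) * φ.quantum)).toRat := by
  set t := (N : ℚ) * φ.quantum with ht
  have hqφ := φ.quantum_pos
  by_cases hex : ∃ x : MiniFloat φ, x.toRat = t
  · obtain ⟨x, hx⟩ := hex
    obtain ⟨z, hz⟩ := exists_toRat_eq_of_le hm.le hq hmax x
    rw [toRat_roundNE_of_exists ⟨z, hz.trans hx⟩, toRat_roundNE_of_exists ⟨x, hx⟩]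
  obtain ⟨hv0, hvt, htu, ⟨u, hu⟩, hgap⟩ := roundDown_bracket h0 hlt hex
  set v := roundDown φ t with hv_def
  set G : ℚ := 2 ^ (v.expCode - 1) * φ.quantum with hG
  have hG0 : 0 < G := by positivity
  have hv2 : 2 ≤ v.expCode := by
    by_contra hlt2
    have hG1 : G = φ.quantum := by rw [hG, show v.expCode - 1 = 0 by omega, pow_zero, one_mul]
    have hvI : v.toRat = (v.toInt : ℚ) * φ.quantum := toRat_eq_toInt_mul v
    rw [hG1, hvI] at htu
    rw [hvI] at hvt
    have A : (v.toInt : ℚ) < N := lt_of_mul_lt_mul_right hvt hqφ.le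
    have B : (N : ℚ) < v.toInt + 1 := lt_of_mul_lt_mul_right (by linarith) hqφ.le
    have A' : v.toInt < N := by exact_mod_cast A
    have B' : N < v.toInt + 1 := by exact_mod_cast B
    omega
  obtain ⟨d, hd⟩ : ∃ d : ℕ, φ.quantum = 2 ^ d * ψ.quantum := ⟨_, quantum_eq_two_pow_mul hq⟩
  obtain ⟨zv, hzv⟩ := exists_toRat_eq_of_le hm.le hq hmax v
  obtain ⟨zu, hzu⟩ := exists_toRat_eq_of_le hm.le hq hmax u
  have hgapψ : ∀ y : MiniFloat ψ, y.toRat ≤ zv.toRat ∨ zv.toRat + G ≤ y.toRat := by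
    intro y; rw [hzv]; exact gap_of_manBits_eq hm hd (by omega) hv0 y
  have hzu' : zu.toRat = zv.toRat + G := by rw [hzu, hzv, hu]
  rcases lt_trichotomy t (v.toRat + G / 2) with hlow | hmid | hhigh
  · rw [toRat_roundNE_eq_of_forall_lt ⟨zv, rfl⟩
        (forall_lt_of_mem_low hgapψ (by rw [hzv]; exact hvt.le) (by rw [hzv]; exact hlow)),
      toRat_roundNE_eq_of_forall_lt ⟨v, rfl⟩ (forall_lt_of_mem_low hgap hvt.le hlow), hzv]
  · -- THE TIE: both roundings lie in `{v, u}` and have an even significand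
    have hφ : (roundNE φ t).toRat = v.toRat ∨ (roundNE φ t).toRat = u.toRat := by
      rcases hgap (roundNE φ t) with h | h
      · left
        have := roundNE_nearest t v
        rw [abs_of_nonneg (by linarith), abs_of_nonneg (by linarith)] at this
        linarith
      · right
        have := roundNE_nearest t u
        rw [abs_of_nonpos (by linarith), abs_of_nonpos (by linarith)] at this
        linarith
    have hψ : (roundNE ψ t).toRat = v.toRat ∨ (roundNE ψ t).toRat = u.toRat := by
      rcases hgapψ (roundNE ψ t) with h | h
      · left
        have := roundNE_nearest t zv
        rw [hzv] at h this
        rw [abs_of_nonneg (by linarith), abs_of_nonneg (by linarith)] at this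
        linarith
      · right
        have := roundNE_nearest t zu
        rw [hzu] at this
        rw [hzv] at h
        rw [abs_of_nonpos (by linarith), abs_of_nonpos (by linarith)] at this
        linarith
    have habs1 : |t - u.toRat| = |t - v.toRat| := by
      rw [hu, hmid, show v.toRat + G / 2 - (v.toRat + G) = -(G / 2) by ring,
        show v.toRat + G / 2 - v.toRat = G / 2 by ring, abs_neg]
    have hne : u.toRat ≠ v.toRat := by rw [hu]; exact (lt_add_of_pos_right _ hG0).ne'
    have pφ : 2 ∣ (roundNE φ t).man := by
      rcases hφ with h | h
      · exact roundNE_man_even_of_tie h1 (y := u) (by rw [h, habs1]) (by rw [h]; exact hne)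
      · exact roundNE_man_even_of_tie h1 (y := v) (by rw [h, habs1]) (by rw [h]; exact hne.symm)
    have pψ : 2 ∣ (roundNE ψ t).man := by
      rcases hψ with h | h
      · exact roundNE_man_even_of_tie (hm ▸ h1) (y := zu) (by rw [h, hzu, habs1])
          (by rw [h, hzu]; exact hne)
      · exact roundNE_man_even_of_tie (hm ▸ h1) (y := zv) (by rw [h, hzv, habs1])
          (by rw [h, hzv]; exact hne.symm)
    -- `u` is normal too
    have hSvu : v.scaledMag ≤ u.scaledMag := by
      have : (v.scaledMag : ℚ) * φ.quantum ≤ u.scaledMag * φ.quantum := by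
        rw [← abs_toRat, ← abs_toRat, abs_of_nonneg hv0, abs_of_nonneg (by linarith)]; linarith
      exact_mod_cast le_of_mul_le_mul_right this hqφ
    have hu1 : 1 ≤ u.expCode := by have := ulpExp_mono hSvu; omega
    have hd0 : φ.quantum = 2 ^ 0 * φ.quantum := by rw [pow_zero, one_mul]
    rcases hφ with hrv | hru <;> rcases hψ with hsv | hsu
    · rw [hsv, hrv]
    · exfalso
      refine not_two_dvd_man_and_succ h1 hv0 hu ⟨?_, ?_⟩
      · exact (two_dvd_man_iff_of_scaledMag_eq rfl h1 (by omega)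
          (scaledMag_eq_mul_of_abs_toRat_eq hd0 (by rw [hrv]))).mp pφ
      · exact (two_dvd_man_iff_of_scaledMag_eq hm h1 hu1
          (scaledMag_eq_mul_of_abs_toRat_eq hd (by rw [hsu]))).mp pψ
    · exfalso
      refine not_two_dvd_man_and_succ h1 hv0 hu ⟨?_, ?_⟩
      · exact (two_dvd_man_iff_of_scaledMag_eq hm h1 (by omega)
          (scaledMag_eq_mul_of_abs_toRat_eq hd (by rw [hsv]))).mp pψ
      · exact (two_dvd_man_iff_of_scaledMag_eq rfl h1 hu1
          (scaledMag_eq_mul_of_abs_toRat_eq hd0 (by rw [hru]))).mp pφ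
    · rw [hsu, hru]
  · rw [toRat_roundNE_eq_of_forall_lt ⟨zu, rfl⟩
        (forall_lt_of_mem_high hzu' hgapψ (by rw [hzv]; exact hhigh) (by rw [hzv]; exact htu.le)),
      toRat_roundNE_eq_of_forall_lt ⟨u, rfl⟩ (forall_lt_of_mem_high hu hgap hhigh htu.le), hzu]

/-- SAME PRECISION, WIDER RANGE — the core: for `m_φ = m_ψ ≥ 1`, `L_ψ ≤ L_φ`, `M_φ ≤ M_ψ`, both
formats round every multiple `t` of the `φ`-quantum with `|t| < maxRat φ` to the same value. -/
theorem toRat_roundNE_eq_of_manBits_eq {φ ψ : Format} (hm : φ.manBits = ψ.manBits)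
    (h1 : 1 ≤ φ.manBits) (hq : ψ.qexp ≤ φ.qexp) (hmax : φ.maxRat ≤ ψ.maxRat) {N : ℤ}
    (hN : |(N : ℚ) * φ.quantum| < φ.maxRat) :
    (roundNE ψ ((N : ℚ) * φ.quantum)).toRat = (roundNE φ ((N : ℚ) * φ.quantum)).toRat := by
  rcases lt_trichotomy 0 ((N : ℚ) * φ.quantum) with hpos | hzero | hneg
  · exact toRat_roundNE_eq_of_manBits_eq_pos hm h1 hq hmax hpos (by rwa [abs_of_pos hpos] at hN)
  · rw [← hzero, toRat_roundNE_zero, toRat_roundNE_zero]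
  · have hpos : 0 < ((-N : ℤ) : ℚ) * φ.quantum := by push_cast; linarith
    have hlt : ((-N : ℤ) : ℚ) * φ.quantum < φ.maxRat := by
      rw [abs_of_neg hneg] at hN; push_cast; linarith
    have := toRat_roundNE_eq_of_manBits_eq_pos hm h1 hq hmax hpos hlt
    rw [show ((-N : ℤ) : ℚ) * φ.quantum = -((N : ℚ) * φ.quantum) by push_cast; ring] at this
    simpa only [toRat_roundNE_neg, neg_inj] using this

/-- Saturation, positive side: if `maxRat φ` is a value of `ψ`, every `t ≥ maxRat φ` double-rounds
to `maxRat φ`. -/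
theorem toRat_roundNE_roundNE_of_maxRat_le {φ ψ : Format}
    (htop : ∃ z : MiniFloat ψ, z.toRat = φ.maxRat) {t : ℚ} (h : φ.maxRat ≤ t) :
    (roundNE φ (roundNE ψ t).toRat).toRat = (roundNE φ t).toRat := by
  rw [toRat_roundNE_of_maxRat_le_pos h]
  apply toRat_roundNE_of_maxRat_le_pos
  calc φ.maxRat = (roundNE ψ φ.maxRat).toRat := (toRat_roundNE_of_exists htop).symm
    _ ≤ (roundNE ψ t).toRat := toRat_roundNE_mono h

/-- Saturation, negative side. -/
theorem toRat_roundNE_roundNE_of_le_neg_maxRat {φ ψ : Format}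
    (htop : ∃ z : MiniFloat ψ, z.toRat = φ.maxRat) {t : ℚ} (h : t ≤ -φ.maxRat) :
    (roundNE φ (roundNE ψ t).toRat).toRat = (roundNE φ t).toRat := by
  have := toRat_roundNE_roundNE_of_maxRat_le htop (show φ.maxRat ≤ -t by linarith)
  simpa only [toRat_roundNE_neg, neg_inj] using this

/-- SAME PRECISION, WIDER RANGE (Theorem D-dr, clause (S)): if `m_φ = m_ψ ≥ 1`, `L_ψ ≤ L_φ` and
`M_φ ≤ M_ψ` (so `F_φ ⊆ F_ψ` with equal precisions), double rounding of `φ`-sums through `ψ` is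
innocuous. -/
theorem drAdd_of_manBits_eq {φ ψ : Format} (hm : φ.manBits = ψ.manBits) (h1 : 1 ≤ φ.manBits)
    (hq : ψ.qexp ≤ φ.qexp) (hmax : φ.maxRat ≤ ψ.maxRat) : DRAdd φ ψ := by
  intro a b
  have htop : ∃ z : MiniFloat ψ, z.toRat = φ.maxRat := by
    obtain ⟨z, hz⟩ := exists_toRat_eq_of_le hm.le hq hmax (MiniFloat.top φ)
    exact ⟨z, hz.trans toRat_top⟩
  rw [toRat_add_toRat]
  rcases lt_or_ge |((a.toInt + b.toInt : ℤ) : ℚ) * φ.quantum| φ.maxRat with hlt | hge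
  · rw [toRat_roundNE_eq_of_manBits_eq hm h1 hq hmax hlt, toRat_roundNE_toRat]
  · rcases le_abs'.mp hge with h | h
    · exact toRat_roundNE_roundNE_of_le_neg_maxRat htop h
    · exact toRat_roundNE_roundNE_of_maxRat_le htop h

/-- WIDE INTERMEDIATE (Theorem D-dr, clause (W); the lean seat's Figueroa theorem read as `DRAdd`):
`P_ψ ≥ 2 P_φ + 1`, `bias_φ ≤ bias_ψ`, `M_φ ≤ M_ψ`. [cite: Figueroa1995, §2] -/
theorem drAdd_of_wide {φ ψ : Format} (hm : 2 * φ.manBits + 2 ≤ ψ.manBits) (hb : φ.bias ≤ ψ.bias)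
    (hmax : φ.maxRat ≤ ψ.maxRat) : DRAdd φ ψ :=
  fun a b => toRat_roundNE_roundNE_add hm hb hmax a b

/-! ## §3 The bias exception: binary8p3 / binary8p3f through binary16 -/

/-- PHANTOM WIDE FORMAT: binary16 with one more binade below (bias 16, top code 31, same largest
value `65504`); it contains binary16 and has the same precision. -/
def Binary16W : Format := ⟨10, 16, 31, 2 ^ 10 - 1, by decide⟩

/-- binary16 and its deeper twin round every multiple of the binary16 quantum alike (§2 below
`65504`, common saturation beyond). -/
theorem toRat_roundNE_Binary16W (N : ℤ) :
    (roundNE Binary16W ((N : ℚ) * Binary16.quantum)).toRat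
      = (roundNE Binary16 ((N : ℚ) * Binary16.quantum)).toRat := by
  have htop : Binary16.maxRat = Binary16W.maxRat := by decide +kernel
  rcases lt_or_ge |(N : ℚ) * Binary16.quantum| Binary16.maxRat with hlt | hge
  · exact toRat_roundNE_eq_of_manBits_eq (φ := Binary16) (ψ := Binary16W) rfl (by decide)
      (by decide) htop.le hlt
  · rcases le_abs'.mp hge with h | h
    · have A := toRat_roundNE_of_maxRat_le_pos
        (show Binary16W.maxRat ≤ -((N : ℚ) * Binary16.quantum) by rw [← htop]; linarith)
      have B := toRat_roundNE_of_maxRat_le_pos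
        (show Binary16.maxRat ≤ -((N : ℚ) * Binary16.quantum) by linarith)
      rw [toRat_roundNE_neg] at A B
      linarith
    · rw [toRat_roundNE_of_maxRat_le_pos h,
        toRat_roundNE_of_maxRat_le_pos (show Binary16W.maxRat ≤ _ by rw [← htop]; exact h), htop]

/-- The binary8p3 / binary8p3f quantum `2^-17` is `2^7` binary16 quanta. -/
theorem Binary8p3_quantum : Binary8p3.quantum = ((2 ^ 7 : ℤ) : ℚ) * Binary16.quantum := by
  decide +kernel

/-- The binary8p3f quantum is the binary8p3 quantum. -/
theorem Binary8p3F_quantum : Binary8p3F.quantum = ((2 ^ 7 : ℤ) : ℚ) * Binary16.quantum := by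
  decide +kernel

/-- binary8p3 sums through binary16 are innocuous (`11 ≥ 2·3 + 1`; bias `16 > 15` handled by the
phantom wide format). [cite: Figueroa1995, §2] -/
theorem Binary8p3_add_via_Binary16 : DRAdd Binary8p3 Binary16 := by
  intro a b
  have hs : a.toRat + b.toRat = (((a.toInt + b.toInt) * 2 ^ 7 : ℤ) : ℚ) * Binary16.quantum := by
    rw [toRat_add_toRat, Binary8p3_quantum]; push_cast; ring
  rw [hs, ← toRat_roundNE_Binary16W, ← hs]
  exact toRat_roundNE_roundNE_add (φ := Binary8p3) (ψ := Binary16W) (by decide) (by decide)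
    (by decide +kernel) a b

/-- binary8p3f (= fnuz_e5m2) sums through binary16 are innocuous. [cite: Figueroa1995, §2] -/
theorem Binary8p3F_add_via_Binary16 : DRAdd Binary8p3F Binary16 := by
  intro a b
  have hs : a.toRat + b.toRat = (((a.toInt + b.toInt) * 2 ^ 7 : ℤ) : ℚ) * Binary16.quantum := by
    rw [toRat_add_toRat, Binary8p3F_quantum]; push_cast; ring
  rw [hs, ← toRat_roundNE_Binary16W, ← hs]
  exact toRat_roundNE_roundNE_add (φ := Binary8p3F) (ψ := Binary16W) (by decide) (by decide)
    (by decide +kernel) a b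

end Summit.Ventures.CertifiedArithmetic
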